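import Summits.HodgeConjecture.CorCM.GaloisQuaternionCyclicLiftPredicate
import Mathlib.GroupTheory.SpecificGroups.Quaternion
import HarnessLib

/-!
# `Q₈ × C₆₁ ↪ Gal(K/ℚ)` through `c` with `C₆₁` normal ⟹ BAD — the gen-29 norm pair for `p = 61` in balanced-set form, lifted
# (the balance check split in two kernel runs)

COR-CM (cell `pub-hodgecm2`), binder seat b04 (gen 39), count-neutral own lane «Galois-CM-type classification» (blanket
`CorCM/GaloisQuaternion*`).  KERNEL ONLY: theorems (`decide +kernel` certificates); no definition, no named fact, no `sorry`.  `HC_CM`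
is neither used nor claimed.

The `p = 61` companion of `CorCM/GaloisQuaternionCyclicLiftPredicate` (`p = 17, 19, 37, 43`).  The two-sheet type of the gen-29 norm
pair (`244` elements) and its shifted-difference balanced set (`112` elements, `scratch-g39/q2n/np_pipeline.py`) are numeral-encoded;
the balance condition over the `488` elements of `Q₈ × C₆₁` exceeds the kernel's memory in one `decide +kernel`, so §1 splits it
along a decidable predicate on `g` (two kernel runs).

References: Shimura (1998), §6.2 Thm. 3, §8.2 Prop. 26 [cite: Shimura1998]; Gordon (1999), Thm. 6.4, §9.3
[cite: Gordon1999HodgeAVSurvey].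
-/

noncomputable section

open CategoryTheory CategoryTheory.Limits NumberField
open scoped BigOperators

namespace Summit.HodgeConjecture.CorCM.GaloisModels

open Literature.NumberTheory.ComplexMultiplication
open Literature.AlgebraicGeometry.Motives (AbelianVariety CMType)
open Literature.AlgebraicGeometry.HodgeTheory
open Literature.AlgebraicGeometry.ComplexMultiplication (IsCMTypeRealisation)
open Literature.AlgebraicGeometry.Pohlmann1968
open Literature.Barriers.HodgeConjecture (divisorClassesSpan)
open Summit.HodgeConjecture.CorCM.GaloisRank
open QuaternionGroup

variable {K : Type} [Field K] [NumberField K] [IsCMField K]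

/-! ## §1 The predicate-encoded lift with the balance condition split in two -/

/-- `exists_simple_degenerate_of_quaternion_cyclic_certificate_pred` with the balance hypothesis split along a decidable predicate `R`
on `g` (two smaller kernel computations). [cite: Shimura1998, §6.2 Thm. 3 and §8.2 Prop. 26] [cite: Gordon1999HodgeAVSurvey, Thm. 6.4 and §9.3] -/
theorem exists_simple_degenerate_of_quaternion_cyclic_certificate_pred_split [IsGalois ℚ K] {m p : ℕ} [NeZero m] [NeZero p]
    (hm : 2 ≤ m) (hp : Odd p) (hp1 : p ≠ 1) (hcop : Nat.Coprime (4 * m) p) {A X u : K ≃ₐ[ℚ] K} (hA : orderOf A = 2 * m)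
    (hX : X * X = A ^ m) (hXA : X * A * X⁻¹ = A⁻¹) (hc : A ^ m = (IsCMField.complexConj K).restrictScalars ℚ)
    (hu : orderOf u = p) (hAu : A * u = u * A) (hXu : X * u = u * X) (hnorm : (Subgroup.zpowers u).Normal)
    (P Q R : QuaternionGroup m × Multiplicative (ZMod p) → Prop) [DecidablePred P] [DecidablePred Q] [DecidablePred R]
    (hcm₁ : ∀ x, P x ↔ ¬ P (((a m, 1) : QuaternionGroup m × Multiplicative (ZMod p)) * x))
    (hprim₁ : ∀ v : QuaternionGroup m × Multiplicative (ZMod p), v ≠ 1 → ∃ w, ¬ (P w ↔ P (v * w)))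
    (hbal₁ : ∀ g : QuaternionGroup m × Multiplicative (ZMod p), R g →
      2 * (Finset.univ.filter fun x => Q x ∧ P (x * g)).card = (Finset.univ.filter Q).card)
    (hbal₂ : ∀ g : QuaternionGroup m × Multiplicative (ZMod p), ¬ R g →
      2 * (Finset.univ.filter fun x => Q x ∧ P (x * g)).card = (Finset.univ.filter Q).card)
    (hmov₁ : ∃ x, Q x ∧ ¬ Q (((a m, 1) : QuaternionGroup m × Multiplicative (ZMod p)) * x))
    (hsym₁ : (Finset.univ.filter Q).val.map Prod.fst =
      (Finset.univ.filter Q).val.map fun x => (((a m, 1) : QuaternionGroup m × Multiplicative (ZMod p)) * x).1) :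
    ∃ (Φ : CMType K) (φ₀ : K →+* ℂ) (A : AbelianVariety ℂ) (ι : 𝓞 K →+* End A)
      (θ : K →+* Module.End ℂ (complexBetti A.X 1)),
      IsPrimitive (ℂ ≃+* ℂ) Φ.1 φ₀ ∧ ¬ IsNondegenerate Φ ∧ IsCMTypeRealisation Φ A ι θ ∧ A.IsSimple ∧
      A.dim = Module.finrank ℚ K / 2 ∧
      ∃ n p : ℕ, ∃ x : complexBetti (⨁ fun _ : Fin n => A).X (2 * p), IsRationalClass x ∧
        IsOfHodgeType (⨁ fun _ : Fin n => A).dim (⨁ fun _ : Fin n => A).X (2 * p) p p x ∧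
        x ∉ divisorClassesSpan (⨁ fun _ : Fin n => A).X (⨁ fun _ : Fin n => A).dim p :=
  exists_simple_degenerate_of_quaternion_cyclic_certificate_pred hm hp hp1 hcop hA hX hXA hc hu hAu hXu hnorm P Q hcm₁ hprim₁
    (fun g => if h : R g then hbal₁ g h else hbal₂ g h) hmov₁ hsym₁

/-! ## §2 `p = 61` -/

set_option maxRecDepth 32000 in
set_option maxHeartbeats 1000000 in -- kernel certificate over the 488 elements of `Q₈ × C₆₁`; budget made explicit
/-- **`Q₈ × C₆₁ ↪ Gal(K/ℚ)` through `c`, `C₆₁` normal ⟹ BAD**: `ord A = 4`, `X² = A² = c`, `XAX⁻¹ = A⁻¹`, `ord u = 61`,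
`[A,u] = [X,u] = 1`, `⟨u⟩ ◁ Gal` (balanced certificate of `244 + 112` elements, numeral-encoded, balanced over `C₆₁`; the balance is
checked separately on the two halves `g.2.val < 31` / `≥ 31`). [cite: Shimura1998, §6.2 Thm. 3 and §8.2 Prop. 26]
[cite: Gordon1999HodgeAVSurvey, Thm. 6.4 and §9.3] -/
theorem exists_simple_degenerate_of_quaternionEight_cyclic61_subgroup [IsGalois ℚ K] {A X u : K ≃ₐ[ℚ] K}
    (hA : orderOf A = 4) (hX : X * X = A ^ 2) (hXA : X * A * X⁻¹ = A⁻¹)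
    (hc : A ^ 2 = (IsCMField.complexConj K).restrictScalars ℚ) (hu : orderOf u = 61) (hAu : A * u = u * A)
    (hXu : X * u = u * X) (hnorm : (Subgroup.zpowers u).Normal) :
    ∃ (Φ : CMType K) (φ₀ : K →+* ℂ) (A : AbelianVariety ℂ) (ι : 𝓞 K →+* End A)
      (θ : K →+* Module.End ℂ (complexBetti A.X 1)),
      IsPrimitive (ℂ ≃+* ℂ) Φ.1 φ₀ ∧ ¬ IsNondegenerate Φ ∧ IsCMTypeRealisation Φ A ι θ ∧ A.IsSimple ∧
      A.dim = Module.finrank ℚ K / 2 ∧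
      ∃ n p : ℕ, ∃ x : complexBetti (⨁ fun _ : Fin n => A).X (2 * p), IsRationalClass x ∧
        IsOfHodgeType (⨁ fun _ : Fin n => A).dim (⨁ fun _ : Fin n => A).X (2 * p) p p x ∧
        x ∉ divisorClassesSpan (⨁ fun _ : Fin n => A).X (⨁ fun _ : Fin n => A).dim p :=
  exists_simple_degenerate_of_quaternion_cyclic_certificate_pred_split (m := 2) (p := 61) le_rfl (by decide) (by decide)
    (by decide) hA hX hXA hc hu hAu hXu hnorm
    (fun g => 235506093540369288600152941275527268904130608701721319579593374082602619428184335515207333226334553129429521807978855002187620548156896694089422411 / 2 ^ ((match g.1 with | a i => i.val | xa i => 4 + i.val) * 61 + (Multiplicative.toAdd g.2).val) % 2 = 1)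
    (fun g => 103216267897399071298049167188552281194586396553840293820741798961536706069796734123587372725333172083510129275689190352903476701873247387606321188 / 2 ^ ((match g.1 with | a i => i.val | xa i => 4 + i.val) * 61 + (Multiplicative.toAdd g.2).val) % 2 = 1)
    (fun g => (Multiplicative.toAdd g.2).val < 31)
    (by decide +kernel) (by decide +kernel) (by decide +kernel) (by decide +kernel) (by decide +kernel) (by decide +kernel)

end Summit.HodgeConjecture.CorCM.GaloisModels

end
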